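import Summits.ValiantsHypothesis.ValiantsHypothesis.Theorems.DivisionGapZeroOneTransferFaceIsolationForms
import Summits.ValiantsHypothesis.ValiantsHypothesis.Theorems.ZeroOneTransfer.Negative.Faces
import Summits.ValiantsHypothesis.ValiantsHypothesis.Theorems.DivisionGapZeroOneTransferTriangularDimersVP

/-!
# Crux `DivisionGap.ZeroOneTransfer` (stmt-ValiantsHypothesis-5066), line `charged-uncharged`:
# LATTICE-SUBGRAPH TRANSFER — `D_n` is complete among its edge-restricted sub-families

Support file (`--supports stmt-ValiantsHypothesis-5066`, seat val-width-5066-p1).  The decisive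
instance of the uncharged stub `stub_monotoneMultiples` (MM) is Valiant's rhombus dimer polynomial
`D_n = triPM n`; its faces in INDICATOR directions are the edge-restricted dimer polynomials
`D_n[E₀] = triPMIn E₀` (covers inside an edge predicate `E₀`; Part E vocabulary, p164143), which
include — up to a monomial factor recording a frozen matching — the dimer polynomial of every
sub-region of the rhombus with or without some lattice edges deleted (lattice animals of the
triangular, square = two-direction, and hexagonal-type sub-lattices, Valiant's triangular region
`G_n`, …).

Proved here (all elementary over the semifield `ℝ≥0`, where top forms are free and multiplicative —
`Negative.complexity_topComponent_le`, `Negative.topComponent_mul`):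

* `mm_certificate_descends` — every UNCHARGED certificate for `D_n` descends: if `X ≠ 0` then
  `X' := top_{wInd E₀} X ≠ 0` has `L₊(D_n[E₀] · X') ≤ L₊(D_n · X)`;
* `div_certificate_descends`, `divComplexity_triPMIn_le` — the same with the cofactor charged
  (`divC (D_n[E₀]) ≤ divC (D_n)`);
* `sublattice_divisionEasy_of_triangularDimersDivisionEasy` — crux 4 (`TriangularDimersDivisionEasy`,
  stmt-5067) transfers, with the SAME constant, to every edge-restricted family admitting a cover;
  `sublattice_mm_of_mm_triPM` — the uncharged (MM) analogue;
* `not_triangularDimersDivisionEasy_of_sublattice_hard`, `not_zeroOneTransfer_of_sublattice_hard` —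
  the KILL CRITERION of the crux widened from the single family `D_n` to the whole class: one
  sequence of edge predicates `E n` whose restricted dimer family is division-hard at its
  coverable levels (no constant serves every `n` at which `E n` admits a cover) refutes crux 4 and hence (tree theorem
  `not_zeroOneTransfer_of_not_triangularDimersDivisionEasy`, p144184) the crux `ZeroOneTransfer`.

No claim about MM / CC themselves (open).  Nothing here moves VP ≠ VNP.
[folklore]
-/

noncomputable section

set_option linter.dupNamespace false

namespace Summit.ValiantsHypothesis.ValiantsHypothesis.Theorems.DivisionGapZeroOneTransfer

open MvPolynomial
open Literature.Computability.AlgebraicComplexity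
open Summit.ValiantsHypothesis.ValiantsHypothesis.Theorems.TriangularDimersDivisionEasy.Negative
open Summit.ValiantsHypothesis.ValiantsHypothesis.Theorems.ZeroOneTransfer
open Summit.ValiantsHypothesis.ValiantsHypothesis.Theorems.ZeroOneTransfer.Negative
open FaceIsolation
open scoped NNReal BigOperators

namespace LatticeSubgraph

variable {n : ℕ}

/-- **Uncharged certificates descend to every edge-restricted sub-family.**  If `E₀` admits a cover
and `X ≠ 0`, then the top form `X' = top_{wInd E₀} X` is nonzero and
`L₊(D_n[E₀] · X') ≤ L₊(D_n · X)`: the top form of `D_n · X` along the indicator weight of `E₀` is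
`D_n[E₀] · X'` (`stub_topComponent_wInd_triPM`, `topComponent_mul`) and top forms are free
(`complexity_topComponent_le`). [folklore] -/
theorem mm_certificate_descends (E₀ : Vtx n → Vtx n → Prop) [DecidableRel E₀]
    (hE : ∃ f ∈ dimers n, ∀ v, E₀ v (f v)) {X : MvPolynomial (Var n) ℝ≥0} (hX : X ≠ 0) :
    ∃ X' : MvPolynomial (Var n) ℝ≥0, X' ≠ 0 ∧
      complexity (triPMIn E₀ * X') ≤ complexity (triPM n * X) := by
  refine ⟨topComponent (wInd E₀) X, topComponent_ne_zero (wInd E₀) hX, ?_⟩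
  calc complexity (triPMIn E₀ * topComponent (wInd E₀) X)
      = complexity (topComponent (wInd E₀) (triPM n * X)) := by
        rw [topComponent_mul, stub_topComponent_wInd_triPM n E₀ hE]
    _ ≤ complexity (triPM n * X) := complexity_topComponent_le (wInd E₀) _

/-- **Charged certificates descend**: with `X' = top_{wInd E₀} X`,
`L₊(D_n[E₀] · X') + L₊(X') ≤ L₊(D_n · X) + L₊(X)`. [folklore] -/
theorem div_certificate_descends (E₀ : Vtx n → Vtx n → Prop) [DecidableRel E₀]
    (hE : ∃ f ∈ dimers n, ∀ v, E₀ v (f v)) {X : MvPolynomial (Var n) ℝ≥0} (hX : X ≠ 0) :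
    ∃ X' : MvPolynomial (Var n) ℝ≥0, X' ≠ 0 ∧
      complexity (triPMIn E₀ * X') + complexity X' ≤ complexity (triPM n * X) + complexity X := by
  refine ⟨topComponent (wInd E₀) X, topComponent_ne_zero (wInd E₀) hX, Nat.add_le_add ?_ ?_⟩
  · calc complexity (triPMIn E₀ * topComponent (wInd E₀) X)
        = complexity (topComponent (wInd E₀) (triPM n * X)) := by
          rw [topComponent_mul, stub_topComponent_wInd_triPM n E₀ hE]
      _ ≤ complexity (triPM n * X) := complexity_topComponent_le (wInd E₀) _
  · exact complexity_topComponent_le (wInd E₀) X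

/-- **`divC (D_n[E₀]) ≤ divC (D_n)`** for every edge predicate admitting a cover (Hrubeš–Yehudayoff
division complexity, `Negative.divComplexity`). [folklore] -/
theorem divComplexity_triPMIn_le (E₀ : Vtx n → Vtx n → Prop) [DecidableRel E₀]
    (hE : ∃ f ∈ dimers n, ∀ v, E₀ v (f v)) :
    divComplexity (triPMIn E₀) ≤ divComplexity (triPM n) := by
  rw [← stub_topComponent_wInd_triPM n E₀ hE]
  exact divComplexity_topComponent_le (wInd E₀) (triPM n)

/-- **Crux 4 transfers to every edge-restricted sub-family, with the same constant**: if
`TriangularDimersDivisionEasy` (stmt-ValiantsHypothesis-5067) holds with constant `c`, then for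
every `n` and every edge predicate `E₀` on the `n × n` rhombus admitting a cover, some nonzero `h`
has `L₊(D_n[E₀] · h) + L₊(h) ≤ 2 ^ ((log₂ n + c) ^ c)`. [folklore] -/
theorem sublattice_divisionEasy_of_triangularDimersDivisionEasy
    (H : Summit.ValiantsHypothesis.ValiantsHypothesis.Theses.DivisionGap.TriangularDimersDivisionEasy) :
    ∃ c : ℕ, ∀ (n : ℕ) (E₀ : Vtx n → Vtx n → Prop) [DecidableRel E₀],
      (∃ f ∈ dimers n, ∀ v, E₀ v (f v)) →
        ∃ h : MvPolynomial (Var n) ℝ≥0, h ≠ 0 ∧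
          complexity (triPMIn E₀ * h) + complexity h ≤ bound c n := by
  obtain ⟨c, hc⟩ := crux_iff.mp H
  refine ⟨c, fun n E₀ _ hE => ?_⟩
  obtain ⟨h, hh, hle⟩ := hc n
  obtain ⟨h', hh', hle'⟩ := div_certificate_descends E₀ hE hh
  exact ⟨h', hh', hle'.trans hle⟩

/-- **The uncharged analogue**: an MM-certificate family for `D_n` (SOME nonzero `X_n` with
`L₊(D_n · X_n) ≤ 2 ^ ((log₂ n + c) ^ c)`) yields, with the same `c`, an MM-certificate for every
edge-restricted sub-family admitting a cover. [folklore] -/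
theorem sublattice_mm_of_mm_triPM {c : ℕ}
    (H : ∀ n : ℕ, ∃ X : MvPolynomial (Var n) ℝ≥0, X ≠ 0 ∧ complexity (triPM n * X) ≤ bound c n) :
    ∀ (n : ℕ) (E₀ : Vtx n → Vtx n → Prop) [DecidableRel E₀],
      (∃ f ∈ dimers n, ∀ v, E₀ v (f v)) →
        ∃ X' : MvPolynomial (Var n) ℝ≥0, X' ≠ 0 ∧ complexity (triPMIn E₀ * X') ≤ bound c n := by
  intro n E₀ _ hE
  obtain ⟨X, hX, hle⟩ := H n
  obtain ⟨X', hX', hle'⟩ := mm_certificate_descends E₀ hE hX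
  exact ⟨X', hX', hle'.trans hle⟩

/-- **Kill criterion for crux 4, widened to the class**: if for some sequence of edge predicates
`E n` the restricted dimer family `D_n[E n]` has super-quasi-polynomial division complexity along
its coverable levels — no constant `c` serves every `n` at which `E n` admits a cover (odd `n`
never do: `dimers n = ∅`) — then `TriangularDimersDivisionEasy` fails. [folklore] -/
theorem not_triangularDimersDivisionEasy_of_sublattice_hard
    (E : ∀ n : ℕ, Vtx n → Vtx n → Prop) [∀ n, DecidableRel (E n)]
    (hhard : ¬ ∃ c : ℕ, ∀ n : ℕ, (∃ f ∈ dimers n, ∀ v, E n v (f v)) →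
      ∃ h : MvPolynomial (Var n) ℝ≥0, h ≠ 0 ∧
        complexity (triPMIn (E n) * h) + complexity h ≤ bound c n) :
    ¬ Summit.ValiantsHypothesis.ValiantsHypothesis.Theses.DivisionGap.TriangularDimersDivisionEasy := by
  intro H
  obtain ⟨c, hc⟩ := sublattice_divisionEasy_of_triangularDimersDivisionEasy H
  exact hhard ⟨c, fun n hE => hc n (E n) hE⟩

/-- **Kill criterion for the crux `ZeroOneTransfer`, widened to the class** (composition with the
tree's unconditional `¬ crux 4 → ¬ crux 3`, `not_zeroOneTransfer_of_not_triangularDimersDivisionEasy`,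
p144184): one division-hard edge-restricted sub-family of Valiant's rhombus dimers refutes the
0/1 transfer conjecture. [folklore] -/
theorem not_zeroOneTransfer_of_sublattice_hard
    (E : ∀ n : ℕ, Vtx n → Vtx n → Prop) [∀ n, DecidableRel (E n)]
    (hhard : ¬ ∃ c : ℕ, ∀ n : ℕ, (∃ f ∈ dimers n, ∀ v, E n v (f v)) →
      ∃ h : MvPolynomial (Var n) ℝ≥0, h ≠ 0 ∧
        complexity (triPMIn (E n) * h) + complexity h ≤ bound c n) :
    ¬ Summit.ValiantsHypothesis.ValiantsHypothesis.Theses.DivisionGap.ZeroOneTransfer :=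
  not_zeroOneTransfer_of_not_triangularDimersDivisionEasy
    (not_triangularDimersDivisionEasy_of_sublattice_hard E hhard)

end LatticeSubgraph

end Summit.ValiantsHypothesis.ValiantsHypothesis.Theorems.DivisionGapZeroOneTransfer
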